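import Summits.QuantumAdvantage.QuantumAdvantage.Theorems.CubicForrelationNearExactIsExactBentEighteenSixtyOneSixtyFourths
import Summits.QuantumAdvantage.QuantumAdvantage.Theorems.CubicForrelationNearExactIsExactBentTwentyTwoOneTwentyFiveOneTwentyEighths
import Summits.QuantumAdvantage.QuantumAdvantage.Theorems.CubicForrelationNearExactIsExactKtGapOrder

/-!
# Crux `CubicForrelation.NearExactIsExact` (stmt-QuantumAdvantage-14043) — `n = 18, 22`: the values a cubic BENT side allows above `1 − 7/2^{r+2}`

Certificate seat `b2b-cforr-cert` (gen 45).  HONEST FRAMING: kernel-checked finite-slice COROLLARIES (standard axioms, no certificates) of the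
every-order Kasami–Tokura gap `kt_gap_order` (this generation) and the gen-44 theorems `fo18_bent_ne_61_64`, `fo22_bent_ne_125_128`:
* `n = 18`: for cubic `f, g : 𝔽₂¹⁸ → 𝔽₂` with `g` bent, `Φ(f,g) ∈ {1, 31/32} ∪ (−∞, 121/128]` (`fo18_bent_values`): the dual `d = g̃` has
  degree `≤ 6`, `N = #{f ≠ d}` is a weight of `RM(6,18)` (`d_min = 4096`), and below `1.75·d_min = 7168` the weights are `0, 4096, 6144`
  (`rm_weights_below_seven_quarters_order`), the last one being `Φ = 61/64` (dead);
* `n = 22`: likewise `Φ(f,g) ∈ {1, 63/64} ∪ (−∞, 249/256]` (`fo22_bent_values`; `RM(7,22)`, `d_min = 32768`, `125/128` dead).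
The minimum-weight lines `31/32` (`n = 18`) and `63/64` (`n = 22`) — `f ⊕ g̃` the indicator of a flat — are NOT treated (at `n = 14` the
analogous line `15/16` is dead, `fo_bent_false`).  NOT summit progress; the windows `θ₁₈ ∈ [15/16, 63/64)`, `θ₂₂ ∈ [15/16, 127/128)` are unchanged.

References: T. Kasami, N. Tokura (1970) Thm 1; O. S. Rothaus (1976); X.-D. Hou (1998); DISPROOF.md §18.4.  Axioms: the standard three.
-/

set_option linter.dupNamespace false -- D-0017: single-problem summit ⇒ `QuantumAdvantage.QuantumAdvantage` by design

noncomputable section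

namespace Summit.QuantumAdvantage.QuantumAdvantage.Theorems.CubicForrelation.NearExactIsExact

open Finset
open Literature.Computability.QuantumComplexity
open Literature.Computability.QuantumComplexity.DerivativeWalsh (W)

/-- **The bent side at `n = 18`.**  For cubic `f, g : 𝔽₂¹⁸ → 𝔽₂` with `g` bent (`W_g² ≡ 2¹⁸`): `Φ(f,g) = 1`, or `Φ(f,g) = 31/32`
(the minimum-weight line, not excluded here), or `Φ(f,g) ≤ 121/128`.  Finite-slice statement; NOT summit progress. [this work] -/
theorem fo18_bent_values (f g : (Fin (9 + 9) → Bool) → Bool) (hf : IsDegLeFun 3 f) (hg : IsDegLeFun 3 g)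
    (hbent : ∀ x, W (fun y => signOf (g y)) x ^ 2 = (2 : ℝ) ^ (9 + 9)) :
    forrelation f g = 1 ∨ forrelation f g = 31 / 32 ∨ forrelation f g ≤ 121 / 128 := by
  classical
  obtain ⟨d, hd⟩ := bb_exists_dual hbent
  have hdeg : IsDegLeFun (5 + 1) d := stub_houCubic stub_axParity 9 g d hg hd
  have he : IsDegLeFun (4 + 2) (fun x => f x ^^ d x) := bb_isDegLeFun_bxor (hf.mono (by norm_num)) hdeg
  have hΦ := bb_forrelation_eq_of_dual f g d hd
  rw [← bb_filter_bxor_eq] at hΦ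
  set N := #(univ.filter fun x : Fin (9 + 9) → Bool => (f x ^^ d x) = true) with hNdef
  have c18 : (2 : ℝ) ^ (9 + 9) = 262144 := by norm_num
  rw [c18] at hΦ
  have h6144 : N ≠ 6144 := by
    intro h
    have : forrelation f g = 61 / 64 := by rw [hΦ, h]; norm_num
    exact fo18_bent_ne_61_64 f g hf hg hbent this
  have hP6 : (2 : ℕ) ^ (4 + 2) = 64 := by norm_num
  have hP7 : (2 : ℕ) ^ (4 + 2 + 1) = 128 := by norm_num
  have hP8 : (2 : ℕ) ^ (4 + 2 + 2) = 256 := by norm_num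
  have hP18 : (2 : ℕ) ^ (9 + 9) = 262144 := by norm_num
  by_cases hlt : N < 7168
  · have hw := rm_weights_below_seven_quarters_order (r := 4 + 2) (m := 9 + 9) (by norm_num) _ he (by rw [hP8, hP18]; omega)
    rw [← hNdef, hP6, hP7, hP18] at hw
    have hcases : N = 0 ∨ N = 4096 := by omega
    rcases hcases with h0 | h1
    · left; rw [hΦ, h0]; norm_num
    · right; left; rw [hΦ, h1]; norm_num
  · right; right
    push Not at hlt
    rw [hΦ]
    have : (7168 : ℝ) ≤ N := by exact_mod_cast hlt
    have h1 : 2 * (7168 : ℝ) / 262144 ≤ 2 * (N : ℝ) / 262144 := by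
      apply div_le_div_of_nonneg_right _ (by norm_num); linarith
    calc 1 - 2 * (N : ℝ) / 262144 ≤ 1 - 2 * 7168 / 262144 := by linarith
      _ = 121 / 128 := by norm_num

/-- **The bent side at `n = 22`.**  For cubic `f, g : 𝔽₂²² → 𝔽₂` with `g` bent (`W_g² ≡ 2²²`): `Φ(f,g) = 1`, or `Φ(f,g) = 63/64`
(the minimum-weight line, not excluded here), or `Φ(f,g) ≤ 249/256`.  Finite-slice statement; NOT summit progress. [this work] -/
theorem fo22_bent_values (f g : (Fin (11 + 11) → Bool) → Bool) (hf : IsDegLeFun 3 f) (hg : IsDegLeFun 3 g)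
    (hbent : ∀ x, W (fun y => signOf (g y)) x ^ 2 = (2 : ℝ) ^ (11 + 11)) :
    forrelation f g = 1 ∨ forrelation f g = 63 / 64 ∨ forrelation f g ≤ 249 / 256 := by
  classical
  obtain ⟨d, hd⟩ := bb_exists_dual hbent
  have hdeg : IsDegLeFun (6 + 1) d := stub_houCubic stub_axParity 11 g d hg hd
  have he : IsDegLeFun (5 + 2) (fun x => f x ^^ d x) := bb_isDegLeFun_bxor (hf.mono (by norm_num)) hdeg
  have hΦ := bb_forrelation_eq_of_dual f g d hd
  rw [← bb_filter_bxor_eq] at hΦ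
  set N := #(univ.filter fun x : Fin (11 + 11) → Bool => (f x ^^ d x) = true) with hNdef
  have c22 : (2 : ℝ) ^ (11 + 11) = 4194304 := by norm_num
  rw [c22] at hΦ
  have h49152 : N ≠ 49152 := by
    intro h
    have : forrelation f g = 125 / 128 := by rw [hΦ, h]; norm_num
    exact fo22_bent_ne_125_128 f g hf hg hbent this
  have hP7 : (2 : ℕ) ^ (5 + 2) = 128 := by norm_num
  have hP8 : (2 : ℕ) ^ (5 + 2 + 1) = 256 := by norm_num
  have hP9 : (2 : ℕ) ^ (5 + 2 + 2) = 512 := by norm_num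
  have hP22 : (2 : ℕ) ^ (11 + 11) = 4194304 := by norm_num
  by_cases hlt : N < 57344
  · have hw := rm_weights_below_seven_quarters_order (r := 5 + 2) (m := 11 + 11) (by norm_num) _ he (by rw [hP9, hP22]; omega)
    rw [← hNdef, hP7, hP8, hP22] at hw
    have hcases : N = 0 ∨ N = 32768 := by omega
    rcases hcases with h0 | h1
    · left; rw [hΦ, h0]; norm_num
    · right; left; rw [hΦ, h1]; norm_num
  · right; right
    push Not at hlt
    rw [hΦ]
    have : (57344 : ℝ) ≤ N := by exact_mod_cast hlt
    have h1 : 2 * (57344 : ℝ) / 4194304 ≤ 2 * (N : ℝ) / 4194304 := by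
      apply div_le_div_of_nonneg_right _ (by norm_num); linarith
    calc 1 - 2 * (N : ℝ) / 4194304 ≤ 1 - 2 * 57344 / 4194304 := by linarith
      _ = 249 / 256 := by norm_num

end Summit.QuantumAdvantage.QuantumAdvantage.Theorems.CubicForrelation.NearExactIsExact

end
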